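import Mathlib
import Summits.Ventures.PercRepro.PuncturedLYMCapTable

/-!
# PercRepro — THE VALUE-BLOCK PIPELINE ON ONE INSTANCE: TWO DISJOINT PAIRS AT LEVEL 2 ON SEVEN POINTS
(p10, gen 42)

A demonstration that `puncturedNMP_of_ok` is usable as stated: the members `{0,1}`, `{2,3}` of `Fin 7`, level `2`
(`#P = 19` rows, `#Y = 35` columns, `R = 35/19`).  The β-table of the cap-`1` stage is `β(1) = 43/114`, `β(2) = 41/57`,
`β(3) = 1` (the all-block column), and the four leaf identities (one per block `B ⊆ 𝒞`) are checked by `norm_num`.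
Nothing here asserts (SP).
-/

namespace PercRepro.PuncturedLYM.Split.Peel.Demo

open Finset PercRepro.PuncturedLYM.Split.Peel

/-- The two members. -/
def pairs : Fin 2 → Finset (Fin 7) := ![{0, 1}, {2, 3}]

/-- The β-table of the instance: only the cap-`1` stage has removal probabilities. -/
def tbl : Finset (Fin 7) → Finset (Finset (Fin 7)) → ℕ → ℕ → ℚ → ℚ → ℕ → ℚ :=
  fun _ _ _ _ _ _ c => if c = 1 then 43 / 114 else if c = 2 then 41 / 57 else if c = 3 then 1 else 0

/-- The family as a finset. -/
theorem image_pairs : (univ : Finset (Fin 2)).image pairs = {({0, 1} : Finset (Fin 7)), {2, 3}} := by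
  decide

/-- The table is admissible on the instance. -/
theorem capOK_pairs :
    CapOK 2 tbl 1 univ ((univ : Finset (Fin 2)).image pairs) 2 1 (1 / (2 : ℚ)) (35 / 19) := by
  rw [image_pairs]
  simp only [CapOK]
  refine ⟨rfl, ?_, ?_, ?_⟩
  · intro c
    simp only [tbl]
    split_ifs <;> norm_num
  · intro c hc
    have : c = 3 := by omega
    subst this
    simp [tbl]
  · intro B hB _
    have hmem : B ∈ ({({0, 1} : Finset (Fin 7)), {2, 3}} : Finset (Finset (Fin 7))).powerset := mem_powerset.2 hB
    have hpow : ({({0, 1} : Finset (Fin 7)), {2, 3}} : Finset (Finset (Fin 7))).powerset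
        = {∅, {({0, 1} : Finset (Fin 7))}, {({2, 3} : Finset (Fin 7))}, {({0, 1} : Finset (Fin 7)), {2, 3}}} := by
      decide
    rw [hpow] at hmem
    simp only [mem_insert, mem_singleton] at hmem
    rcases hmem with rfl | rfl | rfl | rfl
    · have h1 : ((univ \ blockUnion (∅ : Finset (Finset (Fin 7)))) \
          blockUnion (({({0, 1} : Finset (Fin 7)), {2, 3}} : Finset (Finset (Fin 7))) \ ∅)).card = 3 := by decide
      have h2 : (({({0, 1} : Finset (Fin 7)), {2, 3}} : Finset (Finset (Fin 7))) \ ∅).card = 2 := by decide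
      simp only [tbl, h1, h2, card_empty]
      norm_num
    · have h1 : ((univ \ blockUnion ({({0, 1} : Finset (Fin 7))} : Finset (Finset (Fin 7)))) \
          blockUnion (({({0, 1} : Finset (Fin 7)), {2, 3}} : Finset (Finset (Fin 7))) \ {({0, 1} : Finset (Fin 7))})).card = 3 := by
        decide
      have h2 : (({({0, 1} : Finset (Fin 7)), {2, 3}} : Finset (Finset (Fin 7))) \ {({0, 1} : Finset (Fin 7))}).card = 1 := by
        decide
      have h3 : ({({0, 1} : Finset (Fin 7))} : Finset (Finset (Fin 7))).card = 1 := by decide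
      simp only [tbl, h1, h2, h3]
      norm_num
    · have h1 : ((univ \ blockUnion ({({2, 3} : Finset (Fin 7))} : Finset (Finset (Fin 7)))) \
          blockUnion (({({0, 1} : Finset (Fin 7)), {2, 3}} : Finset (Finset (Fin 7))) \ {({2, 3} : Finset (Fin 7))})).card = 3 := by
        decide
      have h2 : (({({0, 1} : Finset (Fin 7)), {2, 3}} : Finset (Finset (Fin 7))) \ {({2, 3} : Finset (Fin 7))}).card = 1 := by
        decide
      have h3 : ({({2, 3} : Finset (Fin 7))} : Finset (Finset (Fin 7))).card = 1 := by decide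
      simp only [tbl, h1, h2, h3]
      norm_num
    · have h1 : ((univ \ blockUnion ({({0, 1} : Finset (Fin 7)), {2, 3}} : Finset (Finset (Fin 7)))) \
          blockUnion (({({0, 1} : Finset (Fin 7)), {2, 3}} : Finset (Finset (Fin 7))) \
            {({0, 1} : Finset (Fin 7)), {2, 3}})).card = 3 := by decide
      have h2 : (({({0, 1} : Finset (Fin 7)), {2, 3}} : Finset (Finset (Fin 7))) \
          {({0, 1} : Finset (Fin 7)), {2, 3}}).card = 0 := by decide
      have h3 : ({({0, 1} : Finset (Fin 7)), {2, 3}} : Finset (Finset (Fin 7))).card = 2 := by decide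
      simp only [tbl, h1, h2, h3]
      norm_num

/-- **(SP) for two disjoint pairs at level 2 on seven points, by the value-block pipeline.** -/
theorem puncturedNMP_pairs :
    PuncturedNMP 2 ((univ : Finset (Fin 2)).biUnion (fun i => upLevel 2 (pairs i))) :=
  puncturedNMP_of_ok tbl pairs (by norm_num) (by decide) (by decide) (by norm_num) capOK_pairs

end PercRepro.PuncturedLYM.Split.Peel.Demo
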